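import Mathlib
import HarnessLib
import Summits.HubbardSuperconductivity.HubbardSuperconductivity.Theorems.KLProgrammeH10TwoPointLimitFramePerturbation

/-!
# Route `KLProgramme` — ENGINE item stmt-HubbardSuperconductivity-20437, located item «(X).3-PINNED-CURRENCY» door (ii): the LADDER SUM of a FLAT cubic per-step source
# `C·(Klam|U|)³` is `≤ C·Klam³·|U|·(cc/log 4 + U²)` in the KL regime `β ≤ exp(cc/U²)` (cell gate-hubbard-kl, seat hubbard-kl-k3c2-p2 g20, technique «thermal-bar
# induction n ≤ nScales β + 1 with EngineBoundsAtV4S sums»)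

WHY.  At the pinned pair the forward-window `D`-row leaves, after the zero-sound cancellation of the kernel's constant part, a per-step source of size `C·(Klam|U|)³`
WITHOUT the `2⁻ⁿ` decay of the ROOM's cubic slot when the kernel's Lipschitz data are read in the engine's scale-resolution (E4) currency (bus 2026-08-28 ≈19:20Z).
Door (ii) of that located item books such a source like the thermal layer — by its LADDER SUM, not per step: over `n ≤ n_β + 1` the sum is
`(n_β + 2)·C·(Klam|U|)³ ≤ C·Klam³·|U|·(cc/log 4 + U²)` because `(n_β + 1)·U² ≤ cc/log 4` (`sq_mul_nScales_succ_le`).  This file is that arithmetic: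
* `flat_cubic_sum_range_le` — `Σ_{n < N} C(Klam|U|)³ = N·C(Klam|U|)³` and for `N ≤ n_β + 2`: `≤ C·Klam³·|U|·(cc/log 4 + U²)`;
* `flat_cubic_sum_Ioc_le` — the same over a window `Ioc t N`.
Pure real arithmetic; nothing about the model is asserted; nothing asserts (X).3, (c), K3 or superconductivity.  0 kit · 0 lit.
-/

noncomputable section

namespace Summit.HubbardSuperconductivity.HubbardSuperconductivity.Theorems.KLRegimeSplit

set_option linter.dupNamespace false -- summit = problem name (single-conjunct summit), D-0017

open Real Finset Literature.MathematicalPhysics.QuantumLattice Literature.Probability.LatticeModels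
open Summit.HubbardSuperconductivity.HubbardSuperconductivity.Theorems.PerturbedFermiCurve

/-- In the KL regime `klBetaMin ≤ β ≤ exp(cc/U²)` (`0 ≤ cc`): `(n_β + 2)·|U|³ ≤ |U|·(cc/log 4 + U²)`. -/
theorem nScales_add_two_mul_abs_cube_le {U cc β : ℝ} (hcc : 0 ≤ cc) (hβ : klBetaMin ≤ β) (hβc : β ≤ Real.exp (cc / U ^ 2)) :
    ((nScales β : ℝ) + 2) * |U| ^ 3 ≤ |U| * (cc / Real.log 4 + U ^ 2) := by
  have h := sq_mul_nScales_succ_le (U := U) hcc hβ hβc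
  have hU : 0 ≤ |U| := abs_nonneg U
  have e3 : |U| ^ 3 = |U| * U ^ 2 := by rw [← sq_abs U]; ring
  rw [e3]
  have : ((nScales β : ℝ) + 2) * (|U| * U ^ 2) = |U| * (U ^ 2 * ((nScales β : ℝ) + 1) + U ^ 2) := by ring
  rw [this]
  exact mul_le_mul_of_nonneg_left (by linarith) hU

/-- **LADDER SUM OF A FLAT CUBIC SOURCE.**  For `0 ≤ C`, `0 ≤ K` and `N ≤ n_β + 2` in the KL regime `klBetaMin ≤ β ≤ exp(cc/U²)` (`0 ≤ cc`):
`Σ_{n < N} C·(K|U|)³ ≤ C·K³·|U|·(cc/log 4 + U²)` — a flat per-step source cubic in `U` sums over the ladder to an `O(|U|)` total. -/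
theorem flat_cubic_sum_range_le {C K U cc β : ℝ} (hC : 0 ≤ C) (hK : 0 ≤ K) (hcc : 0 ≤ cc) (hβ : klBetaMin ≤ β) (hβc : β ≤ Real.exp (cc / U ^ 2))
    {N : ℕ} (hN : N ≤ nScales β + 2) :
    ∑ _n ∈ range N, C * (K * |U|) ^ 3 ≤ C * K ^ 3 * |U| * (cc / Real.log 4 + U ^ 2) := by
  rw [sum_const, card_range, nsmul_eq_mul]
  have h2 := nScales_add_two_mul_abs_cube_le hcc hβ hβc
  have hN' : (N : ℝ) ≤ (nScales β : ℝ) + 2 := by exact_mod_cast hN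
  have hU3 : 0 ≤ |U| ^ 3 := by positivity
  calc (N : ℝ) * (C * (K * |U|) ^ 3) = C * K ^ 3 * ((N : ℝ) * |U| ^ 3) := by ring
    _ ≤ C * K ^ 3 * (((nScales β : ℝ) + 2) * |U| ^ 3) := by
        exact mul_le_mul_of_nonneg_left (mul_le_mul_of_nonneg_right hN' hU3) (by positivity)
    _ ≤ C * K ^ 3 * (|U| * (cc / Real.log 4 + U ^ 2)) := mul_le_mul_of_nonneg_left h2 (by positivity)
    _ = _ := by ring

/-- The same over a window `Ioc t N` with `N ≤ n_β + 1` (at most `n_β + 1 ≤ n_β + 2` steps). -/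
theorem flat_cubic_sum_Ioc_le {C K U cc β : ℝ} (hC : 0 ≤ C) (hK : 0 ≤ K) (hcc : 0 ≤ cc) (hβ : klBetaMin ≤ β) (hβc : β ≤ Real.exp (cc / U ^ 2))
    {t N : ℕ} (hN : N ≤ nScales β + 1) :
    ∑ _n ∈ Ioc t N, C * (K * |U|) ^ 3 ≤ C * K ^ 3 * |U| * (cc / Real.log 4 + U ^ 2) := by
  rw [sum_const, Nat.card_Ioc, nsmul_eq_mul]
  have h2 := nScales_add_two_mul_abs_cube_le hcc hβ hβc
  have hN' : ((N - t : ℕ) : ℝ) ≤ (nScales β : ℝ) + 2 := by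
    have : N - t ≤ nScales β + 2 := by omega
    exact_mod_cast this
  have hU3 : 0 ≤ |U| ^ 3 := by positivity
  calc ((N - t : ℕ) : ℝ) * (C * (K * |U|) ^ 3) = C * K ^ 3 * (((N - t : ℕ) : ℝ) * |U| ^ 3) := by ring
    _ ≤ C * K ^ 3 * (((nScales β : ℝ) + 2) * |U| ^ 3) := by
        exact mul_le_mul_of_nonneg_left (mul_le_mul_of_nonneg_right hN' hU3) (by positivity)
    _ ≤ C * K ^ 3 * (|U| * (cc / Real.log 4 + U ^ 2)) := mul_le_mul_of_nonneg_left h2 (by positivity)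
    _ = _ := by ring

end Summit.HubbardSuperconductivity.HubbardSuperconductivity.Theorems.KLRegimeSplit

end
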